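import Mathlib
import Summits.ResolutionOfSingularities.ResolutionOfSingularities.Theorems.RadicialJungCleanModelsStubLooseCleanOfGiraud15
import Literature.AlgebraicGeometry.Resolution.GiraudFunctionNormalForm
import Literature.AlgebraicGeometry.Resolution.LocalBlowup
import Literature.AlgebraicGeometry.Resolution.TranscendenceDefect
import Literature.RingTheory.PBasis.KimuraNiitsuma1980
import Summits.ResolutionOfSingularities.ResolutionOfSingularities.Theorems.RadicialJungCleanModelsPBasisAtClosedPoint
import Summits.ResolutionOfSingularities.ResolutionOfSingularities.Theorems.RadicialJungCleanModelsPBasisMonomialIdeal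
import Summits.ResolutionOfSingularities.ResolutionOfSingularities.Theorems.RadicialJungCleanModelsPBasisDualDerivations
import Literature.RingTheory.PBasis.KimuraNiitsuma1980Theorem31
import Literature.AlgebraicGeometry.Resolution.RegularLocalRingsProofs
import Mathlib.RingTheory.Jacobson.Ring
import Literature.AlgebraicGeometry.Resolution.FieldsJ2
import Literature.AlgebraicGeometry.Resolution.AffineDomainDimension
import Literature.AlgebraicGeometry.Resolution.ProjectiveSpaceRegular
import Literature.AlgebraicGeometry.Resolution.ResolutionLU
import Literature.AlgebraicGeometry.CossartPiltant200819.Cor46Cofinality2008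
import Literature.AlgebraicGeometry.CossartPiltant200819.Thm21Verbatim2008
import Literature.AlgebraicGeometry.Motives.RatFnSpec
import Summits.ResolutionOfSingularities.ResolutionOfSingularities.Theorems.RadicialJungCleanModelsCleanLU3ArcPackage
import Summits.ResolutionOfSingularities.ResolutionOfSingularities.Theorems.RadicialJungCleanModelsCleanLU2Extraction
import Summits.ResolutionOfSingularities.ResolutionOfSingularities.Theorems.RadicialJungCleanModelsStubCleanCharts3
import HarnessLib
import Literature.AlgebraicGeometry.Resolution.CossartFunctionNormalForm3

/-!
# Route `RadicialJung`, crux `CleanModels` (stmt-15917) — lens 5, the `k = k̄` anchor of stub :249, part 4/5: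
# Cossart 1987 GLOBAL (the printed theorem `Cossart1987Thm`, F-112) ⟹ Cossart's `ν = 0` along a zero-dimensional valuation

Port (res-B-lead-1 g6) of §10 of the crux workfile `Cruxes/DescentPerfectToAll/Lens5_KbarCossartAnchor.lean` rev 12 (author: res-B-lens-5
g11), proofs verbatim, namespace renamed, DEF-FREE (the workfile's `def derivationConj` becomes the existence statement
`exists_derivationConj`; the along-`v` fact `Cossart1987NuZeroAlongValuationAt p` is spelled out as the conclusion of
`nuZeroAlongValuation_of_cossart1987Thm`), with `NuZeroAt` / `Cossart1987Thm` IMPORTED from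
`Literature/AlgebraicGeometry/Resolution/CossartFunctionNormalForm3.lean` (✓ F-112; NAMED FACT, users take `(h : Cossart1987Thm)`).
OURS · counted 0.  Nothing here proves resolution in characteristic `p`; resolution in char `p` is NOT proved; `Cossart1987Thm` is a
PRINTED theorem typed as a hypothesis.

The «routine affine-chart plumbing» IN KERNEL: (a) `NuZeroAt` is invariant under ring isomorphisms (`nuZeroAt_of_ringEquiv`, conjugating
derivations); (b) a finitely generated model regular of dimension `3` at the closed centre is dominated inside `O` by an everywhere-regular
affine model `A₁ = A[1/h]` of dimension `3` (`exists_regularAffineModel₃`; openness of the regular locus over a field, ✓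
`isOpen_regularLocus_of_finiteType_field`); (c) `f ∈ A`, not a `p`-th power in `K`, is not a `p`-th power in `K(Spec A₁)`
(`not_pthPower_functionField`); (d) apply `Cossart1987Thm` to `(Spec A₁ → Spec k̄, f)` (quasi-projective: ✓ `CP2008.isQuasiProjectiveOver_of_isAffine`);
the output `π : X' → Spec A₁` is proper, birational and dominant (`isBirational_and_denseRange`); (e) the LANDED extraction ✓
`exists_model_of_proper_birational` (`Theorems/RadicialJungCleanModelsCleanLU2Extraction.lean`: valuative criterion + affine neighbourhood
of the centre, WITH the stalk isomorphism `δ : 𝒪_{X',x} ≅ locAtCentre T O` and the function-field identification `Θ`) carries the germ of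
`π^* f` to `f`; (f) transport `ν = 0` and regularity along `δ`, re-base `T` over `k` (`Algebra.adjoin_union_eq_adjoin_adjoin`).
-/

noncomputable section

set_option linter.dupNamespace false

open IsLocalRing
open Literature.AlgebraicGeometry.Resolution
open Summit.ResolutionOfSingularities.ResolutionOfSingularities.Theorems.RadicialJung.CleanModels
open Literature.RingTheory.PBasis
open CategoryTheory AlgebraicGeometry TopologicalSpace
open Literature.AlgebraicGeometry.CossartPiltant200819.CP2008
open Literature.AlgebraicGeometry.Motives

namespace Summit.ResolutionOfSingularities.ResolutionOfSingularities.Theorems.RadicialJung.CleanModels.Lens5.KbarCossart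

/-- Conjugating a derivation by a ring isomorphism: a derivation `x ↦ e⁻¹ (D (e x))` of `S` exists for every derivation `D` of `S'`
and every `e : S ≃+* S'`. [folklore] -/
theorem exists_derivationConj {S S' : Type} [CommRing S] [CommRing S'] (e : S ≃+* S') (D : Derivation ℤ S' S') :
    ∃ D' : Derivation ℤ S S, ∀ x, D' x = e.symm (D (e x)) :=
  ⟨{ toFun := fun x => e.symm (D (e x))
     map_add' := fun x y => by simp [map_add]
     map_smul' := fun n x => by simp
     map_one_eq_zero' := by simp
     leibniz' := fun x y => by
       change e.symm (D (e (x * y))) = x * e.symm (D (e y)) + y * e.symm (D (e x))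
       rw [map_mul, Derivation.leibniz, smul_eq_mul, smul_eq_mul, map_add, map_mul, map_mul,
         e.symm_apply_apply, e.symm_apply_apply] }, fun _ => rfl⟩

/-- `NuZeroAt` is invariant under ring isomorphisms of local rings. [folklore] -/
theorem nuZeroAt_of_ringEquiv {S S' : Type} [CommRing S] [IsLocalRing S] [CommRing S'] [IsLocalRing S']
    (e : S ≃+* S') {f : S} (h : NuZeroAt f) : NuZeroAt (e f) := by
  obtain ⟨d, n, hnd, t, b, ht, hd, hJ⟩ := h
  refine ⟨d, n, hnd, e ∘ t, b, ?_, ?_, ?_⟩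
  · have h1 : Ideal.span (Set.range (e ∘ t)) = Ideal.map e.toRingHom (Ideal.span (Set.range t)) := by
      rw [Ideal.map_span, Set.range_comp]; rfl
    rw [h1, ht]
    -- the image of the maximal ideal is the maximal ideal
    have hmax : (Ideal.map e.toRingHom (maximalIdeal S)).IsMaximal :=
      (maximalIdeal.isMaximal S).map_bijective e.toRingHom e.bijective
    exact (IsLocalRing.eq_maximalIdeal hmax)
  · rw [← hd]; exact (ringKrullDim_eq_of_ringEquiv e).symm
  · -- the log-Jacobian sets correspond under `e`
    have hset : {v : S' | ∃ D : Derivation ℤ S' S',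
        (∀ i : Fin n, (e ∘ t) (Fin.castLE hnd i) ∣ D ((e ∘ t) (Fin.castLE hnd i))) ∧ D (e f) = v} =
        e.toRingHom '' {v : S | ∃ D : Derivation ℤ S S,
          (∀ i : Fin n, t (Fin.castLE hnd i) ∣ D (t (Fin.castLE hnd i))) ∧ D f = v} := by
      ext v
      simp only [Set.mem_setOf_eq, Set.mem_image, Function.comp_apply, RingEquiv.toRingHom_eq_coe,
        RingHom.coe_coe]
      constructor
      · rintro ⟨D, hD, rfl⟩
        obtain ⟨Dc, hDc⟩ := exists_derivationConj e D
        refine ⟨Dc f, ⟨Dc, fun i => ?_, rfl⟩, by rw [hDc, e.apply_symm_apply]⟩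
        obtain ⟨c, hc⟩ := hD i
        refine ⟨e.symm c, ?_⟩
        rw [hDc, hc, map_mul, e.symm_apply_apply]
      · rintro ⟨v, ⟨D, hD, rfl⟩, rfl⟩
        obtain ⟨Dc, hDc⟩ := exists_derivationConj e.symm D
        refine ⟨Dc, fun i => ?_, by rw [hDc, e.symm_symm, e.symm_apply_apply]⟩
        obtain ⟨c, hc⟩ := hD i
        refine ⟨e c, ?_⟩
        rw [hDc, e.symm_symm, e.symm_apply_apply, hc, map_mul]
    have h2 : Ideal.span (e.toRingHom '' {v : S | ∃ D : Derivation ℤ S S,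
          (∀ i : Fin n, t (Fin.castLE hnd i) ∣ D (t (Fin.castLE hnd i))) ∧ D f = v}) =
        Ideal.span (e.toRingHom '' {∏ i : Fin n, t (Fin.castLE hnd i) ^ b i}) := by
      rw [← Ideal.map_span, hJ, Ideal.map_span]
    rw [hset, h2]
    congr 1
    simp only [Set.image_singleton, RingEquiv.toRingHom_eq_coe, RingHom.coe_coe, map_prod, map_pow,
      Function.comp_apply]

/-- **Regular affine model in dimension `3`** (Steps 1–4a of the landed dimension-`2` version
✓ `exists_regularAffineModel_of_regularAtCentre`, with `2 ↦ 3`): a finitely generated model `A ⊆ O` of `K/k`, regular of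
dimension `3` at the (closed) centre of `O`, is dominated by `A₁ = A[1/h] ⊆ O`, finitely generated, `Frac A₁ = K`, REGULAR
EVERYWHERE, `dim A₁ = 3` (openness of the regular locus of a finitely generated algebra over a field, ✓ `FieldsJ2`). [folklore] -/
theorem exists_regularAffineModel₃ (k : Type) [Field k] (K : Type) [Field K] [Algebra k K]
    (O : ValuationSubring K) (A : Subalgebra k K)
    (hAO : A.toSubring ≤ O.toSubring) (hAfg : A.FG) (hfrac : IsFractionRing A K)
    (hreg : IsRegularLocalRing (locAtCentre A.toSubring O))
    (hdim : ringKrullDim (locAtCentre A.toSubring O) = 3)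
    (hmax : (subringCentre A.toSubring O hAO).IsMaximal) :
    ∃ (A₁ : Subalgebra k K), A₁.toSubring ≤ O.toSubring ∧ A ≤ A₁ ∧ A₁.FG ∧ IsFractionRing A₁ K ∧
      IsRegularRing A₁ ∧ ringKrullDim A₁ = 3 := by
  haveI : IsFractionRing A K := hfrac
  have hdimA : ringKrullDim A = 3 := by
    rw [← ringKrullDim_locAtCentre_eq_of_isMaximal A hAfg O hAO hmax]; exact hdim
  haveI : Algebra.FiniteType k A := A.fg_iff_finiteType.mp hAfg
  have hregOpen : IsOpen (regularLocus A) := isOpen_regularLocus_of_finiteType_field k A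
  let 𝔮 := subringCentre A.toSubring O hAO
  haveI : 𝔮.IsPrime := subringCentre.isPrime A.toSubring O hAO
  have hreg_loc : IsRegularLocalRing (Localization.AtPrime 𝔮) := by
    rw [← isRegularLocalRing_locAtCentre_iff hAO]; exact hreg
  let P : PrimeSpectrum A := ⟨𝔮, inferInstance⟩
  have hPreg : P ∈ regularLocus A := by rw [mem_regularLocus]; exact hreg_loc
  haveI : IsNoetherianRing A := Algebra.FiniteType.isNoetherianRing k A
  obtain ⟨U, ⟨h, rfl⟩, hhP, hhU⟩ :=
    PrimeSpectrum.isTopologicalBasis_basic_opens.exists_subset_of_mem_open hPreg hregOpen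
  have hh𝔮 : h ∉ 𝔮 := hhP
  have hvh : O.valuation (h : K) = 1 := by
    have hle : O.valuation (h : K) ≤ 1 := O.valuation_le_one ⟨h, hAO h.2⟩
    have hnlt : ¬ O.valuation (h : K) < 1 := fun hlt => hh𝔮 (by rw [mem_subringCentre_iff]; exact hlt)
    exact le_antisymm hle (not_lt.mp hnlt)
  have hh0 : (h : K) ≠ 0 := fun h0 => by rw [h0, map_zero] at hvh; exact zero_ne_one hvh
  have hhinvO : (h : K)⁻¹ ∈ O := by
    rw [← ValuationSubring.valuation_le_one_iff, map_inv₀, hvh, inv_one]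
  obtain ⟨s₀, rfl⟩ := hAfg
  let s₁ : Set K := insert (h : K)⁻¹ (s₀ : Set K)
  let A₁ := Algebra.adjoin k s₁
  have hle : Algebra.adjoin k (s₀ : Set K) ≤ A₁ := Algebra.adjoin_mono (Set.subset_insert _ _)
  have hA₁O : A₁.toSubring ≤ O.toSubring := by
    have h1 : A₁ ≤ { carrier := (O : Set K)
                     mul_mem' := fun ha hb => O.toSubring.mul_mem ha hb
                     one_mem' := O.toSubring.one_mem
                     add_mem' := fun ha hb => O.toSubring.add_mem ha hb
                     zero_mem' := O.toSubring.zero_mem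
                     algebraMap_mem' := fun c => hAO ((Algebra.adjoin k (s₀ : Set K)).algebraMap_mem c) } := by
      refine Algebra.adjoin_le ?_
      rintro z (rfl | hz)
      · exact hhinvO
      · exact hAO (Algebra.subset_adjoin hz)
    exact fun z hz => h1 hz
  haveI hfr₁ : IsFractionRing A₁ K := isFractionRing_of_le hle hfrac
  have hA₁fg : A₁.FG := by
    classical
    exact ⟨insert (h : K)⁻¹ s₀, by push_cast; rfl⟩
  haveI : Algebra.FiniteType k A₁ := A₁.fg_iff_finiteType.mp hA₁fg
  haveI hNR₁ : IsNoetherianRing A₁ := Algebra.FiniteType.isNoetherianRing k A₁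
  have hregA₁ : IsRegularRing A₁ := isRegularRing_adjoin_insert_inv (s₀ : Set K) h hh0 hhU
  have htrdeg : Algebra.trdeg k K = 3 := by
    rw [trdeg_eq_trdeg_of_isFractionRing (Algebra.adjoin k (s₀ : Set K))]
    obtain ⟨n, hn, htr⟩ := exists_ringKrullDim_eq_and_trdeg_eq k (Algebra.adjoin k (s₀ : Set K))
    rw [hdimA] at hn
    have hn3 : n = 3 := by exact_mod_cast hn.symm
    rw [htr, hn3]; rfl
  have hA₁dim : ringKrullDim A₁ = 3 := by
    obtain ⟨n, hn, htr⟩ := exists_ringKrullDim_eq_and_trdeg_eq k A₁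
    rw [← trdeg_eq_trdeg_of_isFractionRing A₁, htrdeg] at htr
    have hn3 : n = 3 := by exact_mod_cast htr.symm
    rw [hn, hn3]; rfl
  exact ⟨A₁, hA₁O, hle, hA₁fg, hfr₁, hregA₁, hA₁dim⟩

/-! ### Spec-level facts -/

/-- The structure morphism `Spec A ⟶ Spec k` of a finitely generated `k`-algebra is locally of finite type. [folklore] -/
theorem locallyOfFiniteType_Spec (k : Type) [Field k] (A : Type) [CommRing A] [Algebra k A] [Algebra.FiniteType k A] :
    LocallyOfFiniteType (Spec.map (CommRingCat.ofHom (algebraMap k A))) :=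
  (HasRingHomProperty.Spec_iff (P := @LocallyOfFiniteType)).mpr (RingHom.finiteType_algebraMap.mpr ‹_›)

/-- A morphism of integral schemes which is an isomorphism over a non-empty open is birational and dominant. [folklore] -/
theorem isBirational_and_denseRange {X' X : Scheme.{0}} [IsIntegral X'] [IsIntegral X] (π : X' ⟶ X)
    (U : X.Opens) (hU : (U : Set X).Nonempty) [IsIso (π ∣_ U)] :
    IsBirational π ∧ DenseRange π.base := by
  -- a point of `π ⁻¹ U` over each point of `U`
  have hsurj : Function.Surjective (π ∣_ U).base :=
    (Scheme.homeoOfIso (asIso (π ∣_ U))).surjective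
  have hsub : (U : Set X) ⊆ Set.range π.base := by
    intro u hu
    obtain ⟨y, hy⟩ := hsurj ⟨u, hu⟩
    refine ⟨(π ⁻¹ᵁ U).ι.base y, ?_⟩
    have := congrArg (fun f => f.base y) (morphismRestrict_ι π U)
    change (π ∣_ U ≫ U.ι) y = ((π ⁻¹ᵁ U).ι ≫ π) y at this
    rw [Scheme.Hom.comp_apply, Scheme.Hom.comp_apply, hy] at this
    exact this.symm
  have hUd : Dense (U : Set X) := U.isOpen.dense hU
  have hpre : ((π ⁻¹ᵁ U : X'.Opens) : Set X').Nonempty := by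
    obtain ⟨u, hu⟩ := hU
    obtain ⟨y, _⟩ := hsurj ⟨u, hu⟩
    exact ⟨(π ⁻¹ᵁ U).ι.base y, by
      have := Scheme.Opens.range_ι (π ⁻¹ᵁ U)
      rw [← this]; exact ⟨y, rfl⟩⟩
  exact ⟨⟨U, hUd, (π ⁻¹ᵁ U).isOpen.dense hpre, inferInstance⟩, hUd.mono hsub⟩

/-- On `Spec R` (`R` a domain with fraction field `K`), a global section whose image in `K` is not a `p`-th power is not a
`p`-th power in the function field. [folklore] -/
theorem not_pthPower_functionField (R : CommRingCat.{0}) [IsDomain R] (K : Type) [Field K] [Algebra R K]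
    [IsFractionRing R K] (p : ℕ) (a : R) (ha : ∀ c : K, c ^ p ≠ algebraMap R K a) :
    ∀ c : (Spec R).functionField,
      c ^ p ≠ ((Spec R).presheaf.germ ⊤ (genericPoint (Spec R)) trivial) ((Scheme.ΓSpecIso R).inv a) := by
  intro c hc
  -- `K(Spec R)` and `K` are both fraction fields of `R`
  let e : (Spec R).functionField ≃ₐ[R] K := IsLocalization.algEquiv (nonZeroDivisors R) _ _
  apply ha (e c)
  have h1 : e (algebraMap R (Spec R).functionField a) = algebraMap R K a := e.commutes a
  rw [← RatFn.algebraMap_functionField_Spec] at hc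
  rw [← h1, ← map_pow, hc]

/-- Transport of «regular at the centre, `f` in the local ring, `ν = 0`» along an equality of subrings. [folklore] -/
theorem nuZeroAtCentre_of_toSubring_eq {K : Type} [Field K] (O : ValuationSubring K) {S S' : Subring K}
    (e : S' = S) (f : K)
    (h : ∃ (_ : IsRegularLocalRing (locAtCentre S O)) (hf : f ∈ locAtCentre S O),
      NuZeroAt (⟨f, hf⟩ : ↥(locAtCentre S O))) :
    ∃ (_ : IsRegularLocalRing (locAtCentre S' O)) (hf : f ∈ locAtCentre S' O),
      NuZeroAt (⟨f, hf⟩ : ↥(locAtCentre S' O)) := by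
  subst e; exact h

/-- **Cossart 1987 GLOBAL ⟹ Cossart's `ν = 0` along a zero-dimensional valuation, `k = k̄`** (the lens-5 along-`v` shape
`Cossart1987NuZeroAlongValuationAt p`, spelled out; the «routine affine-chart plumbing» in kernel): for `k` algebraically closed of
characteristic `p`, a finitely generated `k`-model `A ⊆ O` of `K`, regular of dimension `3` at the (closed) centre of the zero-dimensional
valuation ring `O`, and `f ∈ A` not a `p`-th power in `K`, there is a finitely generated `A' ⊇ A` inside `O`, regular at the centre, with
`NuZeroAt f` at `locAtCentre A' O`.  Proof: restrict to a regular affine neighbourhood `Spec A₁` of the closed centre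
(`exists_regularAffineModel₃`), apply `Cossart1987Thm` to `(Spec A₁, f)`, lift `Spec O → Spec A₁` to the proper model `X' → Spec A₁` by the
valuative criterion and extract a finitely generated model `T ⊆ O` with `𝒪_{X',x} ≅ locAtCentre T O` carrying the germ of `π^* f` to `f`
(✓ `exists_model_of_proper_birational`), transport `ν = 0` along the ring isomorphism (`nuZeroAt_of_ringEquiv`), and re-base `T` over `k`.
[folklore] -/
theorem nuZeroAlongValuation_of_cossart1987Thm (h : Cossart1987Thm) (p : ℕ) [Fact p.Prime]
    (k : Type) [Field k] [CharP k p] [IsAlgClosed k] (K : Type) [Field K] [Algebra k K]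
    (O : ValuationSubring K) (A : Subalgebra k K) (hAO : A.toSubring ≤ O.toSubring) (hAfg : A.FG)
    (hfr : IsFractionRing A K) (hreg : IsRegularLocalRing (locAtCentre A.toSubring O))
    (hdim3 : ringKrullDim (locAtCentre A.toSubring O) = 3)
    (hzd : ∀ (T : Subring K) (hT : T ≤ O.toSubring), A.toSubring ≤ T → (subringCentre T O hT).IsMaximal)
    (f : K) (hfA : f ∈ A) (hfp : ∀ c : K, c ^ p ≠ f) :
    ∃ (A' : Subalgebra k K), A'.toSubring ≤ O.toSubring ∧ A ≤ A' ∧ A'.FG ∧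
    ∃ (_ : IsRegularLocalRing (locAtCentre A'.toSubring O)) (hf : f ∈ locAtCentre A'.toSubring O),
      NuZeroAt (⟨f, hf⟩ : ↥(locAtCentre A'.toSubring O)) := by
  classical
  -- Step 1: a regular affine model `A₁ ⊇ A` inside `O`
  obtain ⟨A₁, hA₁O, hAA₁, hA₁fg, hfr₁, hregA₁, hdimA₁⟩ :=
    exists_regularAffineModel₃ k K O A hAO hAfg hfr hreg hdim3 (hzd _ hAO le_rfl)
  obtain ⟨s₁, rfl⟩ := hA₁fg
  set A₁ := Algebra.adjoin k (s₁ : Set K) with hA₁def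
  haveI := hfr₁
  haveI : IsRegularRing A₁ := hregA₁
  haveI : Algebra.FiniteType k A₁ := A₁.fg_iff_finiteType.mp ⟨s₁, rfl⟩
  haveI : IsNoetherianRing A₁ := Algebra.FiniteType.isNoetherianRing k A₁
  -- Step 2: the scheme `X = Spec A₁` over `k`
  let R : CommRingCat.{0} := CommRingCat.of A₁
  haveI : IsDomain R := inferInstanceAs (IsDomain A₁)
  haveI : IsRegularRing R := inferInstanceAs (IsRegularRing A₁)
  letI : Algebra R K := inferInstanceAs (Algebra A₁ K)
  haveI : IsFractionRing R K := inferInstanceAs (IsFractionRing A₁ K)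
  let X : Scheme.{0} := Spec R
  let sX : X ⟶ Spec (.of k) := Spec.map (CommRingCat.ofHom (algebraMap k A₁))
  haveI : LocallyOfFiniteType sX := locallyOfFiniteType_Spec k A₁
  haveI : IsSeparated sX := inferInstanceAs (IsSeparated (Spec.map (CommRingCat.ofHom (algebraMap k A₁))))
  have hXreg : Scheme.IsRegular X := Scheme.isRegular_Spec R
  have hXdim : topologicalKrullDim X = 3 :=
    (PrimeSpectrum.topologicalKrullDim_eq_ringKrullDim (R := A₁)).trans hdimA₁
  -- the global section `f`
  let a : R := (⟨f, hAA₁ hfA⟩ : A₁)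
  let fX : Γ(X, ⊤) := (Scheme.ΓSpecIso R).inv a
  have hfX : ∀ c : X.functionField, c ^ p ≠ (X.presheaf.germ ⊤ (genericPoint X) trivial) fX :=
    not_pthPower_functionField R K p a (fun c hc => hfp c hc)
  -- Step 3: Cossart's theorem on `(X, f)`
  have hXqp : Literature.AlgebraicGeometry.CossartPiltant200819.CP2008.IsQuasiProjectiveOver sX :=
    Literature.AlgebraicGeometry.CossartPiltant200819.CP2008.isQuasiProjectiveOver_of_isAffine sX
  obtain ⟨X', π, hπ, hX'int, hX'reg, ⟨U, hUne, hUiso⟩, hν⟩ := h p k X sX hXqp hXreg hXdim fX hfX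
  haveI := hπ
  haveI := hX'int
  haveI := hUiso
  obtain ⟨hbir, hdense⟩ := isBirational_and_denseRange π U hUne
  haveI : IsDominant π := ⟨hdense⟩
  -- Step 4: extraction of a finitely generated model at the centre of `O` on `X'`
  obtain ⟨x, T, hTO, hTfg, δ, Θ, hΘδ, hΘπ⟩ :=
    exists_model_of_proper_birational (A := A₁) (K := K) O (fun b => hA₁O b.2) π hπ hbir
  -- Step 5: the germ of `π^* f` at `x` is carried to `f`
  let gx : X'.presheaf.stalk x := X'.presheaf.germ ⊤ x trivial (π.appTop fX)
  have hνx : NuZeroAt gx := hν x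
  have hgen : algebraMap (X'.presheaf.stalk x) X'.functionField gx =
      RatFn.functionFieldMap π (X.presheaf.germ ⊤ (genericPoint X) trivial fX) := by
    have h2 : gx = π.stalkMap x (X.presheaf.germ ⊤ (π.base x) trivial fX) := by
      rw [Scheme.Hom.germ_stalkMap_apply]; rfl
    rw [h2]
    change RatFn.toFunctionField x (π.stalkMap x _) = _
    rw [← RatFn.functionFieldMap_toFunctionField]
    congr 1
    haveI : Nonempty (⊤ : X.Opens) := ⟨⟨genericPoint X, Set.mem_univ _⟩⟩
    exact Scheme.algebraMap_germ_eq_germToFunctionField (X := X) (U := ⊤) (x := π.base x) (Set.mem_univ _) fX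
  have hgx : ((δ gx : ↥(locAtCentre T.toSubring O)) : K) = f := by
    rw [← hΘδ, hgen, hΘπ]
    change algebraMap A₁ K ((Scheme.ΓSpecIso R).hom ((Scheme.ΓSpecIso R).inv a)) = f
    rw [← CommRingCat.comp_apply, Iso.inv_hom_id, CommRingCat.id_apply]
    rfl
  -- Step 6: `f ∈ locAtCentre T O`, regular, `ν = 0` there
  have hfT : f ∈ locAtCentre T.toSubring O := by rw [← hgx]; exact (δ gx).2
  haveI hregT : IsRegularLocalRing (locAtCentre T.toSubring O) := by
    haveI := hX'reg x
    exact IsRegularLocalRing.of_ringEquiv δ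
  have hνT : NuZeroAt (⟨f, hfT⟩ : ↥(locAtCentre T.toSubring O)) := by
    have h1 := nuZeroAt_of_ringEquiv δ hνx
    have heq : δ gx = ⟨f, hfT⟩ := Subtype.ext hgx
    rwa [heq] at h1
  -- Step 7: re-base `T` over `k`
  obtain ⟨t, ht⟩ := hTfg
  have e : (Algebra.adjoin k ((s₁ : Set K) ∪ (t : Set K))).toSubring = T.toSubring := by
    rw [Algebra.adjoin_union_eq_adjoin_adjoin, ← ht]; rfl
  refine ⟨Algebra.adjoin k ((s₁ : Set K) ∪ (t : Set K)), ?_, ?_, ⟨s₁ ∪ t, by push_cast; rfl⟩, ?_⟩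
  · rw [e]; exact hTO
  · exact hAA₁.trans (Algebra.adjoin_mono Set.subset_union_left)
  · exact nuZeroAtCentre_of_toSubring_eq O e f ⟨hregT, hfT, hνT⟩

end Summit.ResolutionOfSingularities.ResolutionOfSingularities.Theorems.RadicialJung.CleanModels.Lens5.KbarCossart

end
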